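import Mathlib
import HarnessLib
import HarnessLib.Audit
import Summits.NavierStokesRegularity.Statement
import Literature.Analysis.FluidPDE.ClassicalSolution
import Literature.Analysis.FluidPDE.LerayHopf
import Literature.Analysis.FluidPDE.SelfSimilar
import Literature.Analysis.FluidPDE.VectorCalculus
import Literature.Analysis.FluidPDE.AxisymmetricEuler
import Literature.Analysis.FluidPDE.NSWave0
import Summits.NavierStokesRegularity.NavierStokesRegularity.Theorems.TypeICertificateLadderNoBlowupToClay
import HarnessLib.Audit.Status.Attr

/-!
Route: GaldiLiouvilleGate

# Route GaldiLiouvilleGate — NavierStokesRegularity (Clay A), positive side (blow-up rescaling at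
ENSTROPHY RECORDS + Liouville rigidity in the finite-Dirichlet class; steady D-solution rungs)
Cards realised: NavierStokesRegularity/NavierStokesRegularity/enstrophy-record-galdi-bridge (spine),
.../critical-rate-galdi-gate, .../axisymmetric-squire-long-far-field; negative consumer named (not
routed): .../d-solution-bubble-gluing.

## Thesis X = X2 ∧ Z ("it suffices to show")
X2 (PARABOLIC GALDI–LIOUVILLE): every bounded ancient mild solution v of NS (ν = 1) on ℝ³×(−∞,0),
smooth, with sup_{s<0} ∫|∇v(s)|² < ∞ and v(s) ∈ L⁶ for all s < 0, is identically zero.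
Z (RECORD ZOOM): if a finite-energy (Leray–Hopf) classical solution from a rapidly decaying datum
admits no smooth extension past T, then zooming at enstrophy records (r_n = ν²/E(t_n), E = ∫|∇u|²)
produces a NONTRIVIAL such v with sup_s ∫|∇v(s)|² ≤ 1.
Lean (elaborates, Sketch.lean rc 0; decls ParabolicGaldiLiouville, RecordZoomAncient):
 X2: ∀ v, Literature.Analysis.FluidPDE.IsBoundedAncientMildSolution 1 v → ContDiffOn ℝ ⊤ (uncurry v)
(Iio 0 ×ˢ univ) → (∃ C, ∀ s<0, ∫⁻ y, ofReal (frobeniusNormSq (fderiv ℝ (v s) y)) ≤ C) → (∀ s<0,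
MemLp (v s) 6) → ∀ s<0, ∀ y, v s y = 0
 Z: ∀ ν T>0 ∀ u p, IsClassicalNSSolutionOn (Ico 0 T) ν 0 u p → IsLerayHopfOn T ν 0 (u 0) u →
HasRapidSpatialDecay (u 0) → ¬HasSmoothExtensionPast ν 0 u T → ∃ v, IsBoundedAncientMildSolution 1 v
∧ smooth ∧ (∀ s<0, ∫⁻|∇v(s)|² ≤ 1) ∧ (∀ s<0, MemLp (v s) 6) ∧ ¬(v ≡ 0)

## Assembly X → NavierStokesRegularity
X2 → Z → (NoBlowup → NavierStokesRegularity) → NavierStokesRegularity, PURE LOGIC (proved in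
Sketch.lean: Z hands a nontrivial v, X2 kills it, so every finite-energy classical solution from
Clay data extends past every T; the third hypothesis is the shared local-theory assembly
stmt-NavierStokesRegularity-0055 of route TypeILiouville, re-asked here as support NoBlowupToClay).

## Two-layer plan (D-0019)
Layer 1 (cruxes, ranked): X2 (rank 2) ⊃ GaldiLiouville X_G (rank 4, its STEADY case = Galdi's
Liouville problem for D-solutions) ⊃ AxisymGaldiLiouville X_ax (rank 5) and CriticalRateLiouville
(rank 6, claimed provable now); Z (rank 3). Layer 2 (glue, later, by glued splits once a crux
closes): Z ⇐ record-compactness ∧ production-forces-concentration (P) ∧ no-thin-slow-blow-up (X3);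
X_G ⇐ CriticalRate ∧ slow-regime (a ∈ (1/2,2/3)) ∧ a-priori-rate; X2 ⇐ steady ∧ time-periodic ∧
eternal-with-attained-maximum ∧ general ancient.

Rationale: WHY THIS LINE. Change the clock of the KNSS zoom (KNSS2009 §6, arXiv:0709.3599) from velocity maxima
to ENSTROPHY RECORDS: with ν=1, E(t)=∫|∇u|² is an inverse length, monotone along its own records, so
blow-up limits inherit ∇v ∈ L^∞_s L²_y and v(s) ∈ L⁶ — a class with DECAY AT INFINITY, where
Liouville technology exists and moves (Galdi2011 Thm X.9.5 u∈L^{9/2}; Seregin2016 BMO^{-1};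
ChaeWolf2019; WangYang2026 arXiv:2608.06040), instead of the structureless bounded class of (L)
(route TypeILiouville crux 0057). Clay (A) then reduces to X2 (parabolic Galdi–Liouville) + Z
(record zoom incl. "no thin-slow blow-up"). The steady case of X2 is Galdi's 60-year-old Liouville
problem X_G (Galdi2011 Rem X.9.4; CarrilloPanZhang2018 p.3: "no definite decay rate is known"); the
two top-ranked steady cards supply a NEW MECHANISM for it: rescale a D-solution to infinity at the
Galdi-critical = Onsager-critical rate |x|^{-2/3}, where viscosity scales OUT (ν R^{-1/3}),
blow-downs are steady EULER flows carrying the Bernoulli head H as a first integral, and the exact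
head-flux identity Φ(R) → −ν∫|∇u|² says a nontrivial D-solution is a sink that an inviscid far field
cannot feed (G(H)-layer-cake: ∮ G(H)W·n = 0; Shvydkoy2015 Lemma 6.1 made constructive); in
axisymmetry WITH swirl the far field is a Squire–Long/Grad–Shafranov equilibrium and the sphere flux
∮HW·n = 2π∫H dΨ cancels by signed crossings (KPR technology, swirl-free in print). Imported areas:
parabolic blow-up/concentration-compactness (PDE), steady Euler rigidity via first integrals
(geometric fluid mechanics), Onsager-critical bookkeeping (turbulence theory). No
probabilistic/spectral reformulation: none touches the ∀-datum gap.
RANKED CRUXES. #2 ParabolicGaldiLiouville X2 (hardest; contains X_G; ancient Duhamel tail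
log-divergent in L^∞(H¹∩L⁶)). #3 RecordZoomAncient Z (fast branch = lemma (P)+compactness, expected
provable; residual thin-slow branch X3 may be FALSE — Tao's Type-II cascade is its model
inhabitant). #4 GaldiLiouville X_G (steady, finite Dirichlet integral, u→0; open since Leray 1933).
#5 AxisymGaldiLiouville X_ax (swirl allowed; open, WangYang2026 §1). #6 CriticalRateLiouville
(|u|=O(⟨x⟩^{-2/3}), |∇u|=O(⟨x⟩^{-5/3}), p→0, ANY constants ⇒ u≡0; refuter-checked (F1)–(F3),
unpublished as of arXiv:2608.06040 whose Prop 1.4 is a log short). Support: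
NontrivialDSolutionExists (= ¬X_G as a construction target; hypothesis (H1) of card
d-solution-bubble-gluing), NoBlowupToClay (= stmt-0055).
KILL CRITERIA. NontrivialDSolutionExists proved (a nontrivial D-solution; necessarily slow |x|^{-a},
a∈(1/2,2/3), or Onsager-wild at infinity by CriticalRate) refutes X_G, X2 and (L) at once — close
`refuted:GaldiLiouville`, hand the witness to d-solution-bubble-gluing (Type-II bubble) as a new
negative route. A nontrivial finite-enstrophy ancient/time-periodic solution refutes X2 only — pivot
to X2' := X2 restricted to record-zoom limits (attained sup-enstrophy 1). Z refuted by a thin-slow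
blow-up ⇒ ¬A outright (it is a blow-up). NoBlowup (stmt-0054) proved elsewhere moots the route.
NOT DECOMPOSED (deliberately). Lemma (P) constants and the record-compactness lemma (they are
layer-2 children of Z); the slow regime a∈(1/2,2/3) and the a-priori rate for D-solutions (children
of X_G); KPR-class compactness of axisymmetric blow-downs and pole regularity of Ψ (children of
X_ax); the threshold device (T) of the spine card; any frozen-core/Type-II use of X_G (belongs to
NoTypeII, stmt-0056, other route).
NUMBERS. Known steady Liouville criteria: u∈L^{9/2} (Galdi X.9.5), Δu∈L^{6/5}, u∈BMO^{-1}
(Seregin2016), |ω|=o(|x|^{-5/3}) (KTW 2017), |u|≤C r^{-2/3}log^{-γ}, γ>1/3 axisym. (WangYang2026 Thm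
1.5); none at the exact rate with large constants; axisymmetric-with-swirl open
(CarrilloPanZhang2018 p.3, WangYang2026 §1). Ancient finite-Dirichlet Liouville: only 2-D (KTW IUMJ
71 (2022), doi:10.1512/iumj.2022.71.8978). Items at open: 9 (5 cruxes, 2 support, target, assembly).

Novelty: NOVELTY (searched 2026-08-15: `lit frontier NavierStokesRegularity --since 2022` (30 rows: forward
self-similar 2-D, sharp non-uniqueness, Hou FoCM 2026 — nothing on ancient finite-Dirichlet
Liouville), `lit bridges NavierStokesRegularity --cross any`, `lit search --source arxiv "Liouville
theorem stationary Navier-Stokes D-solutions decay" --year-from 2023` (1: WangYang2026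
arXiv:2608.06040), `lit search --source zbmath "ancient solution Navier-Stokes Liouville Dirichlet"`
(1: KTW IUMJ 2022, 2-D only), OpenAlex budget exhausted (429); plus the three cards' own audited
searches of today: Wang Wendong monograph (panama:341862216892446) ch.2 pp.30-41, §3.5 pp.48-53,
arXiv:2608.06040 pp.1-4, arXiv:1801.07420 p.3, arXiv:1510.03378 pp.2-6,13-14, arXiv:2101.04905
§§3-4, KNSS2009 §§1,6).
Nearest prior art: (a) zoom-to-ancient + Liouville programme KNSS2009 (arXiv:0709.3599 §6 Prop 6.1,
conjecture (L)) and AlbrittonBarker2019 (arXiv:1811.00502) — velocity-maximum / Type-I clocks,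
bounded class; (b) steady Liouville criteria Galdi2011 X.9.5, Seregin2016, ChaeWolf2019, KTW 2017,
WangYang2026 — all integrability/smallness strictly inside the critical rate 2/3; (c)
Korobkov–Pileckas–Russo JMFM 17 (2015) no-swirl axisymmetric Liouville (cylinder test-field
identities, as printed in Wang's monograph Thm 3.5/3.6) and Shvydkoy2015 (homogeneous Euler: flux
lemma 6.1, Prop 5.1 no axisymmetric homogeneous fields); (d) Q.S. Zhang review arXiv:2101.04905 p.4:
hierarchy 'regularity > ancient solut  [refs: 2608.06040, 1801.07420, 1510.03378, 2101.04905, 0709.3599, 1811.00502, WangYang2026, KNSS2009, AlbrittonBarker2019, Galdi2011, Seregin2016, ChaeWolf2019, Shvydkoy2015]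

Barriers (technique_class: blowup-rescaling liouville-rigidity steady-liouville): BARRIERS (catalogue Literature/Barriers/NavierStokesRegularity read: 18 files; technique_class:
blowup-rescaling liouville-rigidity steady-liouville concentration-compactness).
- Literature.Barriers.NavierStokesRegularity.EnergySupercriticality: enstrophy is supercritical
(energyExponent −1 under stDilation, `dissipation_stDilation`); the route uses it ONLY through
monotonicity at its own records, never as a coercive bound across scales; after rescaling the energy
is lost and only Ḣ¹/L⁶ survive. The barrier bites exactly in the thin-slow branch of crux Z (N
structures of size N/E, amplitude E²/N², energy 1/E → 0 pass every energy-class budget) — conceded: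
Z needs structure there, not size.
- Literature.Barriers.NavierStokesRegularity.TaoAveragedBlowup and
Literature.Barriers.NavierStokesRegularity.TruncatedDyadicBlowup (+
Literature.Barriers.NavierStokesRegularity.TruncatedDyadicTypeIBlowup): the record zoom and lemma
(P) are energy-class and WOULD transfer to averaged bilinear forms, so they only relocate the
difficulty; X2/X_G/CriticalRate are proved (or to be proved) with NON-averaged structure: the
pointwise identity u·((u·∇)u+∇p) = u·∇(p+|u|²/2) making the head a first integral of steady Euler,
the exact head-flux identity, stream functions and Γ = ρu_θ in axisymmetry — none exists for Tao's
averaged B̃ (arXiv:1402.0290), whose Type-II cascade is the model inhabitant of Z's thin-slow branch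
(cheap test recorded on the spine card).
- Literature.Barriers.NavierStokesRegula

Novelty grade: new-combination — ROUTE REVIEW gen-1 (refuter f31d8029, 08-15; independent of g40-0 + 8 grounders): KEEP, no blocking objection. Lean: 9 typed decls rc0 (W_galdi.lean); Assembly re-proved pure logic (evidence 0892); 0895→0896 and 0898→¬0895 one-liners (kill criterion type-correct, ∃ν⇔∀ν by U↦cU); zero profile inhabit (refuter refuter-rreview-route-NavierStokesRegula-f31d8029-0, 2026-08-15T14:11:56Z; prior: arXiv:0709.3599 KNSS2009 §6, Galdi2011 X.9.4-9.5, doi:10.1016/j.jfa.2016.06.019 KTW2017, KorobkovPileckasRusso JMFM 17 (2015), Shvydkoy2015, arXiv:1811.00502 AlbrittonBarker2019, arXiv:2005.09691 Tsai2021, doi:10.1007/s00220-026-05555-y Chae CMP 2026, doi:10.1088/1361-6544/ad1efc Cho-Neustupa-Yang 2024 (to clear, acq-02026), arXiv:2608.06040 WangYang2026)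

History (route lifecycle, newest last):
- 2026-08-26T00:42:35Z · DORMANT — reconciler: no traction for 8.2 d (last activity item-evidence-added at 2026-08-17T19:20:02Z); parked, not closed — `ledger route dormant route-NavierStokesRegu (operator:999:3578091)
- 2026-08-27T10:01:11Z · REACTIVATED — reconciler: reactivated — activity statement-checked at 2026-08-27T08:37:06Z after parking at 2026-08-26T00:42:35Z (operator:999:2449492)

sub-problem: NavierStokesRegularity · status: open · opened planner-plancards-NavierStokesRegularity-NavierStokesRegularity-6c78a5c7d1-0 2026-08-15T10:32:11Z · rev 3 · ledger route-NavierStokesRegularity-GaldiLiouvilleGate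
GENERATED by the gate from the ledger (D-0016/17). Provers cite these decls: `theorem foo : Summit.NavierStokesRegularity.NavierStokesRegularity.Theses.GaldiLiouvilleGate.<Decl> := …` in Summits/NavierStokesRegularity/NavierStokesRegularity/Theorems/<Name>.lean.
-/

namespace Summit.NavierStokesRegularity.NavierStokesRegularity.Theses.GaldiLiouvilleGate

open scoped BigOperators Topology Manifold Classical MeasureTheory ProbabilityTheory Matrix InnerProductSpace ComplexConjugate ContinuousMap
open Filter Set Function TopologicalSpace MeasureTheory

attribute [summit_statement] _root_.NavierStokesRegularity

open Literature.NS

/-- item stmt-NavierStokesRegularity-0891 · target · rank 0 · open · by planner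
why it might fail: X2 contains Leray's D-solution Liouville problem (open Aug 2026, arXiv:2608.06040) and has a log-divergent ancient Duhamel tail in L^∞_s(Ḣ¹∩L⁶); Z can fail by vanishing of the record zoom on the thin-slow branch (creeping records, enstrophy fragmenting into N→∞ critical balls) inside energy budget.
sources: KochNadirashviliSereginSverak2009, Galdi2011, arXiv:2608.06040, arXiv:1402.0290
[target] X = X2 ∧ Z: (X2, ParabolicGaldiLiouville) every smooth bounded ancient mild solution of NS
(ν=1) on ℝ³×(−∞,0) with sup_s ∫|∇v(s)|² < ∞ and v(s) ∈ L⁶ is ≡ 0; (Z, RecordZoomAncient) a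
finite-energy classical solution from a rapidly decaying datum with no smooth extension past T
generates, by zooming at enstrophy records r_n = ν²/E(t_n), a NONTRIVIAL such v with sup_s ∫|∇v|² ≤
1. Cards: enstrophy-record-galdi-bridge (spine), critical-rate-galdi-gate,
axisymmetric-squire-long-far-field. [sources: KNSS2009 §6, Galdi2011 Rem X.9.4, arXiv:2608.06040] -/
@[route_item "route-NavierStokesRegularity-GaldiLiouvilleGate"]
def Thesis : Prop :=
  (∀ v : ℝ → EuclideanSpace ℝ (Fin 3) → EuclideanSpace ℝ (Fin 3), Literature.Analysis.FluidPDE.IsBoundedAncientMildSolution 1 v → ContDiffOn ℝ (⊤ : ℕ∞) (Function.uncurry v) (Set.Iio 0 ×ˢ Set.univ) → (∃ C : NNReal, ∀ s < 0, ∫⁻ y, ENNReal.ofReal (Literature.Analysis.FluidPDE.frobeniusNormSq (fderiv ℝ (v s) y)) ≤ C) → (∀ s < 0, MeasureTheory.MemLp (v s) 6 MeasureTheory.volume) → ∀ s < 0, ∀ y, v s y = 0) ∧ (∀ (ν T : ℝ), 0 < ν → 0 < T → ∀ (u : ℝ → EuclideanSpace ℝ (Fin 3) → EuclideanSpace ℝ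 (Fin 3)) (p : ℝ → EuclideanSpace ℝ (Fin 3) → ℝ), Literature.Analysis.FluidPDE.IsClassicalNSSolutionOn (Set.Ico 0 T) ν 0 u p → Literature.Analysis.FluidPDE.IsLerayHopfOn T ν 0 (u 0) u → Literature.Analysis.FluidPDE.HasRapidSpatialDecay (u 0) → ¬ Literature.Analysis.FluidPDE.HasSmoothExtensionPast ν 0 u T → ∃ v : ℝ → EuclideanSpace ℝ (Fin 3) → EuclideanSpace ℝ (Fin 3), Literature.Analysis.FluidPDE.IsBoundedAncientMildSolution 1 v ∧ ContDiffOn ℝ (⊤ : ℕ∞) (Function.uncurry v) (Set.Iio 0 ×ˢ Set.univ) ∧ (∀ s < 0, ∫⁻ y, ENNReal.ofReal (Literature.Analysis.FluidPDE.frobeniusNormSq (fderiv ℝ (v s) y)) ≤ 1) ∧ (∀ s < 0, MeasureTheory.MemLp (v s) 6 MeasureTheory.volume) ∧ ¬ (∀ s < 0, ∀ y, v s y = 0))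

/-- item stmt-NavierStokesRegularity-0893 · crux · rank 2 · open · by planner
why it might fail: Steady case = Leray's D-solution Liouville problem ('remains open', arXiv:2608.06040, 2026); the Duhamel tail from s=−∞ diverges logarithmically exactly in L^∞_s(Ḣ¹∩L⁶), so nothing perturbative works; a nontrivial D-solution or finite-enstrophy ancient flow refutes it (2-D only: arXiv:1903.09969).
sources: Galdi2011, KochNadirashviliSereginSverak2009, Seregin2016, ChaeWolf2019, arXiv:2608.06040, arXiv:1903.09969
[crux] X2, PARABOLIC GALDI–LIOUVILLE (card enstrophy-record-galdi-bridge X2): a bounded ancient mild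
solution v of NS (ν=1) on ℝ³×(−∞,0) (in-tree IsBoundedAncientMildSolution 1 v), smooth on (−∞,0)×ℝ³,
with UNIFORMLY BOUNDED ENSTROPHY sup_{s<0} ∫|∇v(s)|² ≤ C and v(s) ∈ L⁶ for every s<0, vanishes
identically. Weaker than KNSS (L) (stmt-0057: such v are bounded and L⁶ kills the constants that
make (L) delicate), stronger than Galdi's steady D-solution Liouville problem (its steady case =
crux GaldiLiouville) and than Type-I exclusion (a Type-I ancient solution shifted by one time unit
has bounded enstrophy ~(−t)^{-1/2}). Rungs foreseen (layer 2, not filed): steady (GaldiLiouville),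
time-periodic finite-enstrophy flows, eternal flows with an attained enstrophy maximum (threshold
device (T) of the card, GallagherIftimiePlanchon2003), general ancient; first calibration:
axisymmetric class (Lei–Ren–Zhang-type ancient Liouville). Tools named by the cards: Seregin2016
(BMO^{-1}), ChaeWolf2019, KTW JFA 272 (2017), head-flux identity + inviscid blow-down at rate 2/3
(crux CriticalRateLiouville) transported to the time-dependent setting (card
critical-rate-galdi-gate corollary (ii): an ancien -/
@[route_item "route-NavierStokesRegularity-GaldiLiouvilleGate", crux]
def ParabolicGaldiLiouville : Prop :=
  ∀ v : ℝ → EuclideanSpace ℝ (Fin 3) → EuclideanSpace ℝ (Fin 3), Literature.Analysis.FluidPDE.IsBoundedAncientMildSolution 1 v → ContDiffOn ℝ (⊤ : ℕ∞) (Function.uncurry v) (Set.Iio 0 ×ˢ Set.univ) → (∃ C : NNReal, ∀ s < 0, ∫⁻ y, ENNReal.ofReal (Literature.Analysis.FluidPDE.frobeniusNormSq (fderiv ℝ (v s) y)) ≤ C) → (∀ s < 0, MeasureTheory.MemLp (v s) 6 MeasureTheory.volume) → ∀ s < 0, ∀ y, v s y = 0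

/-- item stmt-NavierStokesRegularity-0894 · crux · rank 3 · open · by planner
why it might fail: Non-triviality of the record zoom is not automatic: N→∞ critical bumps of scale N·r_n carry enstrophy fraction 1/N each and rescaled amplitude 1/N, so v_n→0 locally (vanishing) within the energy budget (~N²ν⁴/E); records may creep on this thin-slow branch, modelled by Tao's averaged Type-II cascade.
sources: KochNadirashviliSereginSverak2009, arXiv:1402.0290, doi:10.1512/iumj.2008.57.3716, GallagherIftimiePlanchon2003, Literature.Barriers.NavierStokesRegularity.EnergySupercriticality, Literature.Barriers.NavierStokesRegularity.TaoAveragedBlowup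
[crux] Z, RECORD ZOOM (card enstrophy-record-galdi-bridge items 1, (P), X3 bundled): if a classical
NS solution on ℝ³×[0,T) which is Leray–Hopf from a rapidly decaying datum admits no smooth extension
past T, then there is a NONTRIVIAL bounded ancient mild solution v (ν=1; rescale u by ν), smooth,
with sup_{s<0}∫|∇v(s)|² ≤ 1 and v(s) ∈ L⁶. Mechanism: E(t)=∫|∇u|² → ∞ (H¹ blow-up criterion); at
running maxima t_n put r_n = ν²/E(t_n), v_n(y,s) = (r_n/ν) u(x_n + r_n y, t_n + r_n² s/ν):
∫|∇v_n(s)|² ≤ 1 for all s ≤ 0 with equality at s = 0; Ḣ¹∩L⁶ is subcritical so v_n are uniformly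
smooth/bounded on unit s-windows and converge in C^∞_loc to a mild ancient limit
(record-compactness, expected provable); NON-TRIVIALITY needs vorticity not to 'vanish' at the
critical radius: lemma (P) 'production forces concentration' (∫ω·Sω ≤ ‖∇ω‖² + Cδ^{1/2}E³, Lu–Doering
dE/dt ≤ CE³) gives it on the FAST branch (records growing by a fixed factor within R² critical time
units infinitely often); the residual THIN-SLOW branch (X3 of the card) is the genuinely open part
and is where Type II / Tao-type cascades would live. Layer-2 children foreseen: RecordCompactness,
ProductionForcesConcentration (P), NoThinS -/
@[route_item "route-NavierStokesRegularity-GaldiLiouvilleGate", crux]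
def RecordZoomAncient : Prop :=
  ∀ (ν T : ℝ), 0 < ν → 0 < T → ∀ (u : ℝ → EuclideanSpace ℝ (Fin 3) → EuclideanSpace ℝ (Fin 3)) (p : ℝ → EuclideanSpace ℝ (Fin 3) → ℝ), Literature.Analysis.FluidPDE.IsClassicalNSSolutionOn (Set.Ico 0 T) ν 0 u p → Literature.Analysis.FluidPDE.IsLerayHopfOn T ν 0 (u 0) u → Literature.Analysis.FluidPDE.HasRapidSpatialDecay (u 0) → ¬ Literature.Analysis.FluidPDE.HasSmoothExtensionPast ν 0 u T → ∃ v : ℝ → EuclideanSpace ℝ (Fin 3) → EuclideanSpace ℝ (Fin 3), Literature.Analysis.FluidPDE.IsBoundedAncientMildSolution 1 v ∧ ContDiffOn ℝ (⊤ : ℕ∞) (Function.uncurry v) (Set.Iio 0 ×ˢ Set.univ) ∧ (∀ s < 0, ∫⁻ y, ENNReal.ofReal (Literature.Analysis.FluidPDE.frobeniusNormSq (fderiv ℝ (v s) y)) ≤ 1) ∧ (∀ s < 0, MeasureTheory.MemLp (v s) 6 MeasureTheory.volume) ∧ ¬ (∀ s < 0, ∀ y, v s y = 0)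

/-- item stmt-NavierStokesRegularity-0895 · crux · rank 4 · open · by planner
why it might fail: Leray's problem, open since 1933 ('remains open, even for axisymmetric D-solutions', arXiv:2608.06040, Aug 2026): no decay beyond U∈L⁶ known; printed criteria stop at rate |x|^{-2/3} (L^{9/2}; KTW17/Seregin–Wang small constants; Cho–Neustupa–Yang little-o); slow |x|^{-a}, a∈(1/2,2/3), tails escape.
sources: Galdi2011, Seregin2016, ChaeWolf2019, CarrilloPanZhang2018, WangYang2026, arXiv:2501.03609
[crux] X_G, GALDI'S LIOUVILLE PROBLEM (cards critical-rate-galdi-gate X_G / d-solution-bubble-gluing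
¬(H1)): a smooth steady solution of NS on ℝ³ (in-tree IsLerayProfile ν 0 U P: −νΔU + (U·∇)U + ∇P =
0, div U = 0) with finite Dirichlet integral ∫|∇U|² < ∞ and U → 0 at infinity is ≡ 0. The STEADY
case of ParabolicGaldiLiouville (a nontrivial D-solution is a bounded ancient mild solution with
constant finite enstrophy and L⁶ slices) and of KNSS (L). Open since Leray 1933 (Galdi2011 Rem
X.9.4; CarrilloPanZhang2018 p.3 'no definite decay rate is known'; WangYang2026 §1). Known: U ∈
L^{9/2} (Galdi2011 Thm X.9.5), ΔU ∈ L^{6/5} (Chae 2014), U ∈ BMO^{-1} (Seregin2016), |ω| =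
o(|x|^{-5/3}) (KTW 2017), log-improved criteria (ChaeWolf2019), axisymmetric no-swirl (KPR JMFM 17
(2015)). The cards' programme ('Galdi's gate'): a nontrivial D-solution must be, at infinity,
TAME-CRITICAL (killed by crux CriticalRateLiouville), SLOW (|u| ~ |x|^{-a}, a ∈ (1/2,2/3): blow-down
gives a degree-(−a) steady Euler field, flux-free by the layer-cake; dissipation sits in the
R^{-(2−3a)} linearised correction — a 'linearised layer-cake' identity to find, or W ≡ 0 via
Shvydkoy's conjecture on homogeneous Euler f -/
@[route_item "route-NavierStokesRegularity-GaldiLiouvilleGate"]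
def GaldiLiouville : Prop :=
  ∀ ν : ℝ, 0 < ν → ∀ (U : EuclideanSpace ℝ (Fin 3) → EuclideanSpace ℝ (Fin 3)) (P : EuclideanSpace ℝ (Fin 3) → ℝ), Literature.Analysis.FluidPDE.IsLerayProfile ν 0 U P → ContDiff ℝ (⊤ : ℕ∞) U → ContDiff ℝ (⊤ : ℕ∞) P → (∫⁻ y, ENNReal.ofReal (Literature.Analysis.FluidPDE.frobeniusNormSq (fderiv ℝ U y)) < ⊤) → Filter.Tendsto U (Filter.cocompact (EuclideanSpace ℝ (Fin 3))) (nhds 0) → U = 0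

/-- item stmt-NavierStokesRegularity-0896 · crux · rank 5 · open · by planner
why it might fail: Open with swirl (arXiv:2608.06040, Aug 2026; best: sup_z|u|≤Cr^{-2/3}log^{-γ}, γ>1/3, or rates >2/3; no-swirl only: KPR15). The blow-down needs KPR-class compactness of Ψ up to the axis (annular Dirichlet decay nobody has) and misses swirl concentrating along the axis or log-modulated far fields.
sources: WangYang2026, CarrilloPanZhang2018, arXiv:1403.6921, Shvydkoy2015, KochNadirashviliSereginSverak2009
[crux] X_ax, AXISYMMETRIC D-SOLUTION LIOUVILLE WITH SWIRL (card axisymmetric-squire-long-far-field):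
GaldiLiouville restricted to axisymmetric U (in-tree IsAxisymmetric: equivariance under rotations
about the x₂-axis; swirl allowed). Open (CarrilloPanZhang2018 p.3 'also wide open'; WangYang2026 §1:
best printed criteria |u| = O(r^{-μ}), μ > 2/3, |ω| = O(r^{-β}), β > 5/3, or |u| ≤ C r^{-2/3}
log^{-γ}, γ > 1/3). Mechanism of the card: blow the solution DOWN at its own decay rate (viscosity
ν/(N_R R) → 0 because a nontrivial D-solution cannot decay like 1/|x| — that would put it in
L^{9/2}); limits are axisymmetric steady EULER fields carrying TWO first integrals Γ = ρW_θ and H =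
Q + |W|²/2, i.e. Squire–Long/Bragg–Hawthorne (Grad–Shafranov-type) equilibria Δ*Ψ = ρ²ℋ′(Ψ) −
GG′(Ψ); the sphere head flux is ∮_{∂B_S} H W·n = 2π ∫_{meridian} H dΨ and cancels by SIGNED
CROSSINGS of Ψ-level components (KPR Bernoulli-law technology for Sobolev stream functions,
swirl-free in print), contradicting the head-flux sink Φ(R) → −ν∫|∇u|² < 0 at the critical
normalisation; Shvydkoy2015 Prop 5.1 (no C¹ axisymmetric homogeneous steady Euler fields with decay
exponent in (0,2)) kills every power-law-tame -/
@[route_item "route-NavierStokesRegularity-GaldiLiouvilleGate"]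
def AxisymGaldiLiouville : Prop :=
  ∀ ν : ℝ, 0 < ν → ∀ (U : EuclideanSpace ℝ (Fin 3) → EuclideanSpace ℝ (Fin 3)) (P : EuclideanSpace ℝ (Fin 3) → ℝ), Literature.Analysis.FluidPDE.IsLerayProfile ν 0 U P → Literature.Analysis.FluidPDE.IsAxisymmetric U → ContDiff ℝ (⊤ : ℕ∞) U → ContDiff ℝ (⊤ : ℕ∞) P → (∫⁻ y, ENNReal.ofReal (Literature.Analysis.FluidPDE.frobeniusNormSq (fderiv ℝ U y)) < ⊤) → Filter.Tendsto U (Filter.cocompact (EuclideanSpace ℝ (Fin 3))) (nhds 0) → U = 0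

/-- item stmt-NavierStokesRegularity-0897 · crux · rank 6 · closed · proved by Summit.NavierStokesRegularity.NavierStokesRegularity.Theorems.Wu2026Salvage.criticalRateLiouville_proof (prover) · by planner
why it might fail: False iff a steady solution with O(|x|^{-2/3}) velocity, O(|x|^{-5/3}) gradient exists: Leray's problem exactly where printed criteria stop (small constants: KTW17, Seregin–Wang; little-o/log: Cho–Neustupa–Yang, WangYang2026 Thm 1.5); large C unclaimed (arXiv:2605.05555). Plan risk: q_R→Q in L¹_loc.
sources: WangYang2026, arXiv:2501.03609, arXiv:2605.05555, arXiv:2604.06527, Shvydkoy2015, Galdi2011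
[crux] LIOUVILLE AT GALDI'S CRITICAL RATE, ARBITRARY CONSTANTS (card critical-rate-galdi-gate item
1; refuter-checked (F1)–(F3) on paper, unpublished as of WangYang2026 whose Prop 1.4/Thm 1.5 is a
log short): a smooth steady NS solution (IsLerayProfile ν 0 U P) with |U(y)| ≤ C⟨y⟩^{-2/3}, ‖∇U(y)‖
≤ C⟨y⟩^{-5/3} (ANY C) and P → 0 at infinity is ≡ 0. Proof plan (~6 pp): (F1) HEAD-FLUX MONOPOLE:
div((P+|U|²/2)U) = νΔ(|U|²/2) − ν|∇U|², so Φ(R) := ∮_{∂B_R}(P+|U|²/2)U·n = −ν∫_{B_R}|∇U|² +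
O(R^{-1/3}) → −νD, and |Φ| ≤ C makes D finite without assuming it; (F2) INVISCID BLOW-DOWN: w_R(x) =
R^{2/3}U(Rx), q_R = R^{4/3}P(Rx) solve (w·∇)w + ∇q = νR^{-1/3}Δw exactly; uniformly bounded and
equi-Lipschitz on compacts of ℝ³∖{0}, Arzelà–Ascoli ⇒ Lipschitz steady Euler limit (W,Q) on ℝ³∖{0},
pressure q_R = R_iR_j(w_iw_j) → Q in L¹_loc (Riesz transforms vs |x|^{-4/3}, near/mid/far split; the
one delicate point), no Dirac momentum source at 0; (F3) BERNOULLI LAYER-CAKE: H = Q + |W|²/2 is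
locally Lipschitz with W·∇H = 0 a.e., so div(G(H)W) = 0 for bounded C¹ G and ∮_{∂B_S}G(H)W·n =
∮_{∂B_ε} → 0; with G = id on the range: ∮_{∂B_S} H W·n = 0 for all S, while scale-invariance Φ_U(RS)
= Φ_{w_R}(S) and (F1) f -/
@[route_item "route-NavierStokesRegularity-GaldiLiouvilleGate"]
def CriticalRateLiouville : Prop :=
  ∀ ν : ℝ, 0 < ν → ∀ (U : EuclideanSpace ℝ (Fin 3) → EuclideanSpace ℝ (Fin 3)) (P : EuclideanSpace ℝ (Fin 3) → ℝ), Literature.Analysis.FluidPDE.IsLerayProfile ν 0 U P → ContDiff ℝ (⊤ : ℕ∞) U → ContDiff ℝ (⊤ : ℕ∞) P → (∃ C : ℝ, ∀ y, ‖U y‖ ≤ C * (1 + ‖y‖) ^ (-(2 / 3 : ℝ)) ∧ ‖fderiv ℝ U y‖ ≤ C * (1 + ‖y‖) ^ (-(5 / 3 : ℝ))) → Filter.Tendsto P (Filter.cocompact (EuclideanSpace ℝ (Fin 3))) (nhds 0) → U = 0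

-- `CriticalRateLiouville` holds: proved by `Summit.NavierStokesRegularity.NavierStokesRegularity.Theorems.Wu2026Salvage.criticalRateLiouville_proof` (its module imports this route file, so no `_holds` link can be stated here).

/-- item stmt-NavierStokesRegularity-0055 · support · rank 9 · closed · proved by Summit.NavierStokesRegularity.NavierStokesRegularity.Theorems.typeICertificateLadder_noBlowupToClay_proof @ 8d57e70af7e2 (prover) · by planner
sources: Leray1934, Fefferman2000
Given NoBlowup, build the Clay (A) solution: local finite-energy classical solution for smooth
divergence-free rapidly decaying data (Leray 1934 §III / Fujita–Kato 1964 + LPS smoothing), continue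
past every T using NoBlowup, glue by weak–strong uniqueness (Prodi–Serrin), bounded energy from the
energy inequality, and convert with
Literature.Analysis.FluidPDE.isNavierStokesSolution_and_smooth_iff. Blow-up at spatial infinity is
excluded by CKN ε-regularity applied far out. May take named Literature facts (leray_existence_R3,
ladyzhenskaya_prodi_serrin, weak_strong_uniqueness, fujita_kato_local) as hypotheses if the grounder
so rules. -/
@[route_item "route-NavierStokesRegularity-GaldiLiouvilleGate", crux]
def NoBlowupToClay : Prop :=
  (∀ (ν T : ℝ), 0 < ν → 0 < T → ∀ (u : ℝ → EuclideanSpace ℝ (Fin 3) → EuclideanSpace ℝ (Fin 3)) (p : ℝ → EuclideanSpace ℝ (Fin 3) → ℝ), Literature.Analysis.FluidPDE.IsClassicalNSSolutionOn (Set.Ico 0 T) ν 0 u p → Literature.Analysis.FluidPDE.IsLerayHopfOn T ν 0 (u 0) u → Literature.Analysis.FluidPDE.HasRapidSpatialDecay (u 0) → Literature.Analysis.FluidPDE.HasSmoothExtensionPast ν 0 u T) → NavierStokesRegularity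

/-- `NoBlowupToClay` holds: proved by `Summit.NavierStokesRegularity.NavierStokesRegularity.Theorems.typeICertificateLadder_noBlowupToClay_proof` @ 8d57e70af7e2. -/
theorem NoBlowupToClay_holds : NoBlowupToClay := _root_.Summit.NavierStokesRegularity.NavierStokesRegularity.Theorems.typeICertificateLadder_noBlowupToClay_proof

/-- item stmt-NavierStokesRegularity-0898 · support · rank 9 · open · by planner
sources: Galdi2011, arXiv:1702.05801, CarrilloPanZhang2018
[support] NEGATIVE COMPANION ¬X_G as a construction target (= hypothesis (H1) of card
d-solution-bubble-gluing, NOT routed this window): some ν>0 admits a smooth steady NS solution U ≢ 0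
on ℝ³ with ∫|∇U|² < ∞ and U → 0 at infinity. By CriticalRateLiouville/Galdi X.9.5 a witness must
have a SLOW (|x|^{-a}, 1/2 < a < 2/3) or Onsager-WILD far field; template recorded on the cards
(viscous core absorbing −νD + far field whose blow-downs are σ ≤ 1/3 steady Euler fields with inward
Bernoulli flux; stationary convex integration Choffrut–Székelyhidi 2014 supplies such fields
weakly). Cheapest probe (kit job, card d-solution-bubble-gluing (o)): INVADING SPHERES — Leray's
steady existence in B_R with boundary datum R^{-2/3}W(x/|x|) chosen with positive kinetic-energy
influx, continued numerically in R = 10…10⁴: does D(u_R) ↛ 0 with C¹_loc-convergent interior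
persist? If proved: refutes GaldiLiouville, ParabolicGaldiLiouville and (L) (stmt-0057) at once, and
is a ready-made Type-II bubble core (that card's (B1)–(B4) bookkeeping: junction homogeneity
r^{-3/2}, rate λ ≍ (T−t)|log|^{κ>1}). -/
@[route_item "route-NavierStokesRegularity-GaldiLiouvilleGate"]
def NontrivialDSolutionExists : Prop :=
  ∃ ν : ℝ, 0 < ν ∧ ∃ (U : EuclideanSpace ℝ (Fin 3) → EuclideanSpace ℝ (Fin 3)) (P : EuclideanSpace ℝ (Fin 3) → ℝ), Literature.Analysis.FluidPDE.IsLerayProfile ν 0 U P ∧ ContDiff ℝ (⊤ : ℕ∞) U ∧ ContDiff ℝ (⊤ : ℕ∞) P ∧ (∫⁻ y, ENNReal.ofReal (Literature.Analysis.FluidPDE.frobeniusNormSq (fderiv ℝ U y)) < ⊤) ∧ Filter.Tendsto U (Filter.cocompact (EuclideanSpace ℝ (Fin 3))) (nhds 0) ∧ U ≠ 0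

-- item stmt-NavierStokesRegularity-0925 · support · rank 9 · open · by planner — informal only, no Lean statement yet:
--   [support] (rank 9; informal until a 'modulated quasi-steady core' notion is typed) FROZEN-CORE LEMMA
--   = item 2 of card d-solution-bubble-gluing, the robust residue both novelty audits
--   (refuter-triage-15, refuter-novelty-audit-11, 2026-08-15) asked to have filed regardless of that
--   card's hypothesis (H1): let a finite-energy classical NS solution blow up at (x₀,T) and admit, along
--   t_k ↑ T, the MODULATED form u(x,t_k) = λ_k^{-1} U_k((x − ξ_k)/λ_k) + r_k with λ_k → 0, sup_k
--   ‖U_k‖_{C²(B_A)} < ∞ for every A, remainders r_k smoother at scale λ_k, and BOUNDED CORE REYNOLDS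
--   NUMBER Re_core := ‖u(t_k)‖_∞

/-- item stmt-NavierStokesRegularity-0892 · assembly · rank 1 · closed · proved by Summit.NavierStokesRegularity.NavierStokesRegularity.Theorems.galdiLiouvilleGate_assembly_proof (prover) · by planner
sources: Fefferman2000, KNSS2009
[assembly] ParabolicGaldiLiouville → RecordZoomAncient → NoBlowupToClay → NavierStokesRegularity.
PURE LOGIC (verified sorry-free in the planner's Sketch.lean): fix ν,T,u,p as in NoBlowup; if u had
no smooth extension past T, Z yields a nontrivial finite-enstrophy ancient v, X2 (with C = 1) forces
v ≡ 0, contradiction; hence NoBlowup, and the third hypothesis (= stmt-NavierStokesRegularity-0055,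
the shared local-theory assembly of route TypeILiouville) gives Clay (A). ~8 lines. [sources:
Fefferman2000, KNSS2009] -/
@[route_item "route-NavierStokesRegularity-GaldiLiouvilleGate"]
def Assembly : Prop :=
  (∀ v : ℝ → EuclideanSpace ℝ (Fin 3) → EuclideanSpace ℝ (Fin 3), Literature.Analysis.FluidPDE.IsBoundedAncientMildSolution 1 v → ContDiffOn ℝ (⊤ : ℕ∞) (Function.uncurry v) (Set.Iio 0 ×ˢ Set.univ) → (∃ C : NNReal, ∀ s < 0, ∫⁻ y, ENNReal.ofReal (Literature.Analysis.FluidPDE.frobeniusNormSq (fderiv ℝ (v s) y)) ≤ C) → (∀ s < 0, MeasureTheory.MemLp (v s) 6 MeasureTheory.volume) → ∀ s < 0, ∀ y, v s y = 0) → (∀ (ν T : ℝ), 0 < ν → 0 < T → ∀ (u : ℝ → EuclideanSpace ℝ (Fin 3) → EuclideanSpace ℝ (Fin 3)) (p : ℝ → EuclideanSpace ℝ (Fin 3) → ℝ), Literature.Analysis.FluidPDE.IsClassicalNSSolutionOn (Set.Ico 0 T) ν 0 u p → Literature.Analysis.FluidPDE.IsLerayHopfOn T ν 0 (u 0) u →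 Literature.Analysis.FluidPDE.HasRapidSpatialDecay (u 0) → ¬ Literature.Analysis.FluidPDE.HasSmoothExtensionPast ν 0 u T → ∃ v : ℝ → EuclideanSpace ℝ (Fin 3) → EuclideanSpace ℝ (Fin 3), Literature.Analysis.FluidPDE.IsBoundedAncientMildSolution 1 v ∧ ContDiffOn ℝ (⊤ : ℕ∞) (Function.uncurry v) (Set.Iio 0 ×ˢ Set.univ) ∧ (∀ s < 0, ∫⁻ y, ENNReal.ofReal (Literature.Analysis.FluidPDE.frobeniusNormSq (fderiv ℝ (v s) y)) ≤ 1) ∧ (∀ s < 0, MeasureTheory.MemLp (v s) 6 MeasureTheory.volume) ∧ ¬ (∀ s < 0, ∀ y, v s y = 0)) → ((∀ (ν T : ℝ), 0 < ν → 0 < T → ∀ (u : ℝ → EuclideanSpace ℝ (Fin 3) → EuclideanSpace ℝ (Fin 3)) (p : ℝ → EuclideanSpace ℝ (Fin 3) → ℝ), Literature.Analysis.FluidPDE.IsClassicalNSSolutionOn (Set.Ico 0 T) ν 0 u p → Literature.Analysis.FluidPDE.IsLerayHopfOn T ν 0 (u 0) u → Literature.Analysis.FluidPDE.HasRapidSpatialDecay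 (u 0) → Literature.Analysis.FluidPDE.HasSmoothExtensionPast ν 0 u T) → NavierStokesRegularity) → NavierStokesRegularity

-- `Assembly` holds: proved by `Summit.NavierStokesRegularity.NavierStokesRegularity.Theorems.galdiLiouvilleGate_assembly_proof` (its module imports this route file, so no `_holds` link can be stated here).

/-! D-0027 §2.1 — DECIDING THEOREM (planner-authored via `route open/edit --closes-file`; by planner-rbadge-NavierStokesRegularity-GaldiLio-00a19e0c-g2-0 2026-08-15T16:09:25Z):
its hypotheses are this route's items and its conclusion the sub-problem Statement (glue_lint), and it elaborates with this file. -/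

@[closes "route-NavierStokesRegularity-GaldiLiouvilleGate"] theorem closes (hX2 : ParabolicGaldiLiouville) (hZ : RecordZoomAncient) (hClay : NoBlowupToClay) : NavierStokesRegularity := by
  apply hClay
  intro ν T hν hT u p hcl hLH hdec
  by_contra hext
  obtain ⟨v, hv, hsm, hens, hL6, hne⟩ := hZ ν T hν hT u p hcl hLH hdec hext
  exact hne (hX2 v hv hsm ⟨1, fun s hs => le_of_le_of_eq (hens s hs) ENNReal.coe_one.symm⟩ hL6)

end Summit.NavierStokesRegularity.NavierStokesRegularity.Theses.GaldiLiouvilleGate
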